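import Mathlib

/-!
# Wall bubbling for `DoorA26` — obligation (M), the MIXED-WALL PARITY LAW (Schur parity sieve KILL(j), kernel-grade modulo the collapse regime)

LINE / STUB.  Crux `Theses.LacunarySymmetroid.DoorA26` (stmt-ValiantsHypothesis-19979; OPEN, typed, never asserted), line
`Cruxes/DoorA26/Lines/wall_bubbling.lean` (ideator val-idea-15; critic crit-2), obligation **(M) `Stmt.stub_mixedWalls`**: no accumulation of
twenties at a MIXED wall `2δᵢ = δₖ + δₗ` of the sorted exponent simplex.  (M) is genuinely second-order: the first-order blow-up pattern
`P = Eᵢᵢ − ½(Eₖₗ + Eₗₖ)` IS realisable (`…WallBubblingPureDSieve.pureDSieve_false_without_noMixed`).  This file types and proves the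
SECOND-ORDER obstruction of the card's «SCHUR PARITY SIEVE» (`Lines/wall_bubbling.md`, STATUS (M)) as a kernel theorem about sequences of
realisable Gram matrices, with its one non-degeneracy hypothesis made explicit — a RUNG of (M) (re-pointing W1 of R2664 / director R260 (b)),
not (M) itself and nothing about `DoorA26`.

CONTENT (def-free; the pattern is written as the literal `!![1, 0, 0; 0, 0, -1/2; 0, -1/2, 0]` in the order `(i, k, l)` of a selection
`I : Fin 3 → Fin 6`; «realisable-shaped» = `G = ε • (v vᵀ − u uᵀ − w wᵀ)`, which is what the line's `Realisable` gives through
`(Sym₂ℝ, det) ≅ ℝ^{1,2}`, `realisable_shape` below):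
* `mixedParity_schur_block` / `mixedParity_schur_entry` — the rank-3 SCHUR IDENTITY for the `1 × 1` complement `{j}` of the block `I`
  (`G_jj = G_jI G_II⁻¹ G_Ij`, and its polynomial ADJUGATE form `G_jj · det G_II = ∑ G_{j,Ia} adj(G_II)_{ab} G_{Ib,j}`) — the only piece of
  the shared second-order engine (W3) inlined here;
* `mixedWall_parity_limit` — **PARITY LAW**: if along a sequence of realisable-shaped `G^ν` the `I`-block blows up to the mixed pattern,
  `(B ν)⁻¹ • G^ν_II → P`, and the `j`-cross vector has a limit direction, `(ρ ν)⁻¹ G^ν_{I·,j} → ω`, then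
  `G^ν_jj · B ν / (ρ ν)² → q(ω) := ω₀² − 4 ω₁ ω₂` (`= ω P⁻¹ ωᵀ`, `P⁻¹ = [[1,0,0],[0,0,−2],[0,−2,0]]`); hence (`mixedWall_parity_eventually_pos`)
  if `q(ω) > 0` then eventually `sgn G^ν_jj = sgn B ν = sgn G^ν_ii` (`mixedWall_blownup_sign`);
* `mixedWall_parity_kill` — **KILL(j)**: such a sequence cannot have `G^ν_jj · G^ν_ii < 0` for all `ν`; in the line's use the signs of all
  21 Gram entries of a twenty near a generic wall point are the chamber's alternation signs, so a chamber with `pos(jj) ≢ pos(ii) (mod 2)`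
  admits no accumulation with this anatomy and a non-degenerate cross direction;
* `q_pos_of_opposite_cross_signs` + `cross_limit_nonpos` — with `pos(jk) ≢ pos(jl)` the cross signs are opposite along the sequence, so
  `ω₁ ω₂ ≤ 0` and then `q(ω) > 0` UNLESS `ω₀ = 0 ∧ ω₁ ω₂ = 0`: the only escape is the **COLLAPSE REGIME** — the `j`-cross vector concentrates on
  ONE cross entry `(j,k)` or `(j,l)` (the card's «degenerate-ratio regimes need a nested blow-up: NOT done»).  That regime, and the anatomy
  theorem feeding `hblock` (W3's engine: accumulation at a generic mixed-wall point ⇒ `G_II/B → P`), are what remains of (M) at a killed facet.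
PLACEMENT w.r.t. the line's (M) instrument (`Lines/wall_bubbling_M-sieve.md`, val-idea-15 g2: exact per-point tropical sieve, 85/98 zero-survivor runs):
this is the kernel form of the SIMPLEST Schur-minor item of that sieve — the diagonal minor `M_jj = det G[I∪{j} | I∪{j}]` read at the pair-dominated
scale (soundness-ledger items (iii) Schur + the sign bookkeeping) — in the non-collapse regime; it does not formalise the cluster/regime ledger (items (i)–(ii)),
the SSR/ENS lemmas or the LP verdicts.

HONEST FRAMING.  Cell `pub-symmetroid`, seat val-sym-door-p2 g11 (re-pointed W1), `--supports stmt-ValiantsHypothesis-19979 --as helper`.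
Linear algebra and limits only; no new definitions; (M), (W), (R) and `DoorA26` stay OPEN; registers unchanged; nothing on `MatrixDescartes`
(stmt-ValiantsHypothesis-18050) or `VP ≠ VNP`. [this work; folklore linear algebra (Schur complement of a rank-3 factorisation)]
-/

-- `Summit.ValiantsHypothesis.ValiantsHypothesis.…` repeats a component by the D-0017 layout
-- (single-conjunct summit), which the `dupNamespace` linter flags; the name is mandated.
set_option linter.dupNamespace false

namespace Summit.ValiantsHypothesis.ValiantsHypothesis.Theorems.LacunarySymmetroidMatrixDescartes.WallBubbling

open Matrix Finset Filter Topology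
open scoped BigOperators

/-! ## §1 The rank-3 Schur identity for a `1 × 1` complement -/



/-- The `3 × 6` matrix with rows `v, u, w` (written inline: `Matrix.of ![v, u, w]`) factors a realisable-shaped Gram matrix:
`ε (v vᵀ − u uᵀ − w wᵀ) = Bᵀ · diag(ε, −ε, −ε) · B`. [folklore] -/
theorem mixedParity_gram_eq_factor (ε : ℝ) (v u w : Fin 6 → ℝ) :
    ε • (vecMulVec v v - vecMulVec u u - vecMulVec w w) =
      (Matrix.of ![v, u, w])ᵀ * Matrix.diagonal ![ε, -ε, -ε] * Matrix.of ![v, u, w] := by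
  ext a b
  simp [Matrix.mul_apply, Fin.sum_univ_three, vecMulVec_apply, Matrix.diagonal_apply]
  ring

/-- Blocks of a `Bᵀ J B` factorisation factor through the column selections. [folklore] -/
theorem mixedParity_submatrix_factor (B : Matrix (Fin 3) (Fin 6) ℝ) (J : Matrix (Fin 3) (Fin 3) ℝ) {m n : ℕ}
    (I : Fin m → Fin 6) (C : Fin n → Fin 6) :
    (Bᵀ * J * B).submatrix C I = (B.submatrix id C)ᵀ * J * B.submatrix id I := by
  ext a b
  simp [Matrix.mul_apply, Matrix.submatrix_apply, Matrix.transpose_apply]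

/-- **Rank-3 Schur identity, `1 × 1` complement** (the piece of the shared engine this file needs): for a realisable-shaped
`G = ε (v vᵀ − u uᵀ − w wᵀ)`, a selection `I : Fin 3 → Fin 6` with `det G_II ≠ 0` and an index `j`,
`G_jj = G_jI · G_II⁻¹ · G_Ij`. [folklore] -/
theorem mixedParity_schur_block (ε : ℝ) (v u w : Fin 6 → ℝ) (G : Matrix (Fin 6) (Fin 6) ℝ)
    (hG : G = ε • (vecMulVec v v - vecMulVec u u - vecMulVec w w)) (I : Fin 3 → Fin 6) (j : Fin 6)
    (hI : (G.submatrix I I).det ≠ 0) :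
    G.submatrix ![j] ![j] = G.submatrix ![j] I * (G.submatrix I I)⁻¹ * G.submatrix I ![j] := by
  have hfac : G = (Matrix.of ![v, u, w])ᵀ * Matrix.diagonal ![ε, -ε, -ε] * Matrix.of ![v, u, w] := by
    rw [hG]; exact mixedParity_gram_eq_factor ε v u w
  set B := Matrix.of ![v, u, w] with hB
  set J : Matrix (Fin 3) (Fin 3) ℝ := Matrix.diagonal ![ε, -ε, -ε] with hJdef
  set BI : Matrix (Fin 3) (Fin 3) ℝ := B.submatrix id I with hBI
  set BC : Matrix (Fin 3) (Fin 1) ℝ := B.submatrix id ![j] with hBC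
  have hII : G.submatrix I I = BIᵀ * J * BI := by rw [hfac, mixedParity_submatrix_factor]
  have hCI : G.submatrix ![j] I = BCᵀ * J * BI := by rw [hfac, mixedParity_submatrix_factor]
  have hIC : G.submatrix I ![j] = BIᵀ * J * BC := by rw [hfac, mixedParity_submatrix_factor]
  have hCC : G.submatrix ![j] ![j] = BCᵀ * J * BC := by rw [hfac, mixedParity_submatrix_factor]
  have hdet : BIᵀ.det * J.det * BI.det ≠ 0 := by
    rw [← det_mul, ← det_mul, ← hII]; exact hI
  have hBIu : IsUnit BI.det := isUnit_iff_ne_zero.mpr (mul_ne_zero_iff.mp hdet).2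
  have hJu : IsUnit J.det := isUnit_iff_ne_zero.mpr (mul_ne_zero_iff.mp (mul_ne_zero_iff.mp hdet).1).2
  have hBItu : IsUnit BIᵀ.det := isUnit_iff_ne_zero.mpr (mul_ne_zero_iff.mp (mul_ne_zero_iff.mp hdet).1).1
  rw [hCC, hCI, hIC, hII, Matrix.mul_inv_rev, Matrix.mul_inv_rev]
  simp only [Matrix.mul_assoc]
  rw [Matrix.mul_nonsing_inv_cancel_left _ _ hBIu, Matrix.mul_nonsing_inv_cancel_left _ _ hJu,
    Matrix.nonsing_inv_mul_cancel_left _ _ hBItu]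

/-- **Adjugate form of the Schur entry** (polynomial, hence usable under limits): for realisable-shaped `G` with `det G_II ≠ 0`,
`G_jj · det G_II = ∑_{a,b} G_{j,Ia} · adj(G_II)_{ab} · G_{Ib,j}`. [folklore] -/
theorem mixedParity_schur_entry (ε : ℝ) (v u w : Fin 6 → ℝ) (G : Matrix (Fin 6) (Fin 6) ℝ)
    (hG : G = ε • (vecMulVec v v - vecMulVec u u - vecMulVec w w)) (I : Fin 3 → Fin 6) (j : Fin 6)
    (hI : (G.submatrix I I).det ≠ 0) :
    G j j * (G.submatrix I I).det = ∑ a, ∑ b, G j (I a) * (G.submatrix I I).adjugate a b * G (I b) j := by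
  have h := mixedParity_schur_block ε v u w G hG I j hI
  have h00 := congrFun (congrFun h 0) 0
  simp only [Matrix.submatrix_apply, Matrix.cons_val_zero] at h00
  rw [Matrix.inv_def, Ring.inverse_eq_inv'] at h00
  rw [h00]
  simp only [Matrix.mul_apply, Matrix.submatrix_apply, Matrix.cons_val_zero, Matrix.smul_apply, smul_eq_mul]
  conv_rhs => rw [Finset.sum_comm]
  rw [Finset.sum_mul]
  refine Finset.sum_congr rfl fun b _ => ?_
  rw [Finset.sum_mul, Finset.sum_mul]
  refine Finset.sum_congr rfl fun a _ => ?_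
  field_simp


/-! ## §2 Realisable ⇒ realisable-shaped; symmetry -/

/-- **Bridge from the line's `Realisable`.**  If `G a b = ε · polar(S a, S b)` for symmetric `2 × 2` letters (`polar(S,T) =
(det(S+T) − det S − det T)/2`, the line's `polar`), then `G = ε • (t tᵀ − x xᵀ − y yᵀ)` with `t = (S₀₀+S₁₁)/2`, `x = S₀₁`, `y = (S₀₀−S₁₁)/2`
— the isometry `(Sym₂ℝ, det) ≅ ℝ^{1,2}`. [folklore] -/
theorem realisable_shape (S : Fin 6 → Matrix (Fin 2) (Fin 2) ℝ) (hS : ∀ l, (S l).IsSymm) (ε : ℝ) (G : Matrix (Fin 6) (Fin 6) ℝ)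
    (hG : ∀ a b, G a b = ε * (((S a + S b).det - (S a).det - (S b).det) / 2)) :
    ∃ v u w : Fin 6 → ℝ, G = ε • (vecMulVec v v - vecMulVec u u - vecMulVec w w) := by
  refine ⟨fun a => ((S a) 0 0 + (S a) 1 1) / 2, fun a => (S a) 0 1, fun a => ((S a) 0 0 - (S a) 1 1) / 2, ?_⟩
  ext a b
  have ha : (S a) 1 0 = (S a) 0 1 := by
    have := congrFun (congrFun (hS a) 0) 1; simpa [Matrix.transpose_apply] using this
  have hb : (S b) 1 0 = (S b) 0 1 := by
    have := congrFun (congrFun (hS b) 0) 1; simpa [Matrix.transpose_apply] using this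
  rw [hG a b]
  simp only [Matrix.det_fin_two, Matrix.add_apply, Matrix.smul_apply, Matrix.sub_apply, vecMulVec_apply, smul_eq_mul, ha, hb]
  ring

/-- A realisable-shaped matrix is symmetric. [folklore] -/
theorem shape_symm (ε : ℝ) (v u w : Fin 6 → ℝ) (G : Matrix (Fin 6) (Fin 6) ℝ)
    (hG : G = ε • (vecMulVec v v - vecMulVec u u - vecMulVec w w)) (a b : Fin 6) : G a b = G b a := by
  rw [hG]
  simp only [Matrix.smul_apply, Matrix.sub_apply, vecMulVec_apply, smul_eq_mul]
  ring

/-! ## §3 The parity law (limit form) -/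

/-- **MIXED-WALL PARITY LAW, Schur-hypothesis form.**  For symmetric `G^ν` satisfying the adjugate Schur identity at `(j; I)` whenever
`det G^ν_II ≠ 0`: if `(B ν)⁻¹ • G^ν_II → P = Eᵢᵢ − ½(Eₖₗ+Eₗₖ)` and `(ρ ν)⁻¹ G^ν_{I a, j} → ω a`, then
`G^ν_jj · B ν / (ρ ν)² → ω₀² − 4 ω₁ ω₂`.  Proof: `adj(B•X) = B² adj X`, `det(B•X) = B³ det X`, `adj P = −¼·[[1,0,0],[0,0,−2],[0,−2,0]]`,
`det P = −¼`. [this work] -/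
theorem mixedWall_parity_limit_of_schur
    (G : ℕ → Matrix (Fin 6) (Fin 6) ℝ)
    (hsymm : ∀ ν a b, G ν a b = G ν b a)
    (I : Fin 3 → Fin 6) (j : Fin 6) (B ρ : ℕ → ℝ) (hB : ∀ ν, B ν ≠ 0) (hρ : ∀ ν, 0 < ρ ν)
    (hschur : ∀ ν, ((G ν).submatrix I I).det ≠ 0 →
      G ν j j * ((G ν).submatrix I I).det = ∑ a, ∑ b, G ν j (I a) * ((G ν).submatrix I I).adjugate a b * G ν (I b) j)
    (hblock : Tendsto (fun ν => (B ν)⁻¹ • (G ν).submatrix I I) atTop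
      (𝓝 !![(1 : ℝ), 0, 0; 0, 0, -1/2; 0, -1/2, 0]))
    (ω : Fin 3 → ℝ) (hcross : Tendsto (fun ν a => (ρ ν)⁻¹ * G ν (I a) j) atTop (𝓝 ω)) :
    Tendsto (fun ν => G ν j j * B ν / ρ ν ^ 2) atTop (𝓝 (ω 0 ^ 2 - 4 * ω 1 * ω 2)) := by
  set P : Matrix (Fin 3) (Fin 3) ℝ := !![(1 : ℝ), 0, 0; 0, 0, -1/2; 0, -1/2, 0] with hP
  set X : ℕ → Matrix (Fin 3) (Fin 3) ℝ := fun ν => (B ν)⁻¹ • (G ν).submatrix I I with hX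
  have hGX : ∀ ν, (G ν).submatrix I I = B ν • X ν := by
    intro ν; simp only [hX, smul_smul, mul_inv_cancel₀ (hB ν), one_smul]
  have hdetP : P.det = -1/4 := by
    simp [hP, Matrix.det_fin_three]; norm_num
  -- convergence of det and adjugate of X
  have hdetX : Tendsto (fun ν => (X ν).det) atTop (𝓝 P.det) :=
    ((continuous_id.matrix_det).tendsto P).comp hblock
  have hadjX : Tendsto (fun ν => (X ν).adjugate) atTop (𝓝 P.adjugate) :=
    ((continuous_id.matrix_adjugate).tendsto P).comp hblock
  have hdetne : ∀ᶠ ν in atTop, (X ν).det ≠ 0 := hdetX.eventually_ne (by rw [hdetP]; norm_num)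
  -- the rescaled quadratic form e ν := ∑ (G(Ia)j/ρ) adj(X) (G(Ib)j/ρ)
  have hcomp : ∀ a, Tendsto (fun ν => (ρ ν)⁻¹ * G ν (I a) j) atTop (𝓝 (ω a)) := fun a =>
    tendsto_pi_nhds.1 hcross a
  have hadj_ab : ∀ a b, Tendsto (fun ν => (X ν).adjugate a b) atTop (𝓝 (P.adjugate a b)) := fun a b =>
    tendsto_pi_nhds.1 (tendsto_pi_nhds.1 hadjX a) b
  have he : Tendsto (fun ν => ∑ a, ∑ b, ((ρ ν)⁻¹ * G ν (I a) j) * (X ν).adjugate a b * ((ρ ν)⁻¹ * G ν (I b) j))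
      atTop (𝓝 (∑ a, ∑ b, ω a * P.adjugate a b * ω b)) := by
    refine tendsto_finsetSum _ fun a _ => tendsto_finsetSum _ fun b _ => ?_
    exact ((hcomp a).mul (hadj_ab a b)).mul (hcomp b)
  -- the value of the limit form
  have hval : (∑ a, ∑ b, ω a * P.adjugate a b * ω b) = -(1/4) * (ω 0 ^ 2 - 4 * ω 1 * ω 2) := by
    rw [hP, Matrix.adjugate_fin_three_of]
    simp [Fin.sum_univ_three]
    ring
  -- the identity (G_jj B / ρ²) · det X = e ν, eventually
  have hid : ∀ᶠ ν in atTop, G ν j j * B ν / ρ ν ^ 2 =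
      (∑ a, ∑ b, ((ρ ν)⁻¹ * G ν (I a) j) * (X ν).adjugate a b * ((ρ ν)⁻¹ * G ν (I b) j)) / (X ν).det := by
    filter_upwards [hdetne] with ν hν
    have hdetG : ((G ν).submatrix I I).det = B ν ^ 3 * (X ν).det := by
      rw [hGX ν, Matrix.det_smul]; simp
    have hadjG : ((G ν).submatrix I I).adjugate = B ν ^ 2 • (X ν).adjugate := by
      rw [hGX ν, Matrix.adjugate_smul]; simp
    have hI : ((G ν).submatrix I I).det ≠ 0 := by
      rw [hdetG]; exact mul_ne_zero (pow_ne_zero _ (hB ν)) hν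
    have hs := hschur ν hI
    rw [hdetG, hadjG] at hs
    simp only [Matrix.smul_apply, smul_eq_mul] at hs
    have hρ' : ρ ν ≠ 0 := (hρ ν).ne'
    have hB' := hB ν
    rw [eq_div_iff hν]
    -- hs : G j j * (B^3 det X) = ∑∑ G j (I a) * (B^2 * adj a b) * G (I b) j
    have : (∑ a, ∑ b, (ρ ν)⁻¹ * G ν (I a) j * (X ν).adjugate a b * ((ρ ν)⁻¹ * G ν (I b) j)) =
        (ρ ν)⁻¹ ^ 2 * (B ν ^ 2)⁻¹ * ∑ a, ∑ b, G ν j (I a) * (B ν ^ 2 * (X ν).adjugate a b) * G ν (I b) j := by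
      rw [Finset.mul_sum]
      refine Finset.sum_congr rfl fun a _ => ?_
      rw [Finset.mul_sum]
      refine Finset.sum_congr rfl fun b _ => ?_
      rw [hsymm ν j (I a)]
      field_simp
    rw [this, ← hs]
    field_simp
  -- conclude
  have hlim : Tendsto (fun ν => (∑ a, ∑ b, ((ρ ν)⁻¹ * G ν (I a) j) * (X ν).adjugate a b * ((ρ ν)⁻¹ * G ν (I b) j)) / (X ν).det)
      atTop (𝓝 ((∑ a, ∑ b, ω a * P.adjugate a b * ω b) / P.det)) :=
    he.div hdetX (by rw [hdetP]; norm_num)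
  rw [hval, hdetP] at hlim
  have hfin : -(1 / 4) * (ω 0 ^ 2 - 4 * ω 1 * ω 2) / (-1 / 4) = ω 0 ^ 2 - 4 * ω 1 * ω 2 := by ring
  rw [hfin] at hlim
  exact hlim.congr' (hid.mono fun ν h => h.symm)


/-- **MIXED-WALL PARITY LAW** (realisable-shaped form): along a sequence of realisable-shaped `G^ν` whose `I`-block blows up to the
mixed pattern (`(B ν)⁻¹ • G^ν_II → P`) and whose `j`-cross vector has the limit direction `ω` at scale `ρ ν`,
`G^ν_jj · B ν / (ρ ν)² → q(ω) = ω₀² − 4 ω₁ ω₂`. [this work] -/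
theorem mixedWall_parity_limit
    (G : ℕ → Matrix (Fin 6) (Fin 6) ℝ)
    (hshape : ∀ ν, ∃ (ε : ℝ) (v u w : Fin 6 → ℝ), G ν = ε • (vecMulVec v v - vecMulVec u u - vecMulVec w w))
    (I : Fin 3 → Fin 6) (j : Fin 6) (B ρ : ℕ → ℝ) (hB : ∀ ν, B ν ≠ 0) (hρ : ∀ ν, 0 < ρ ν)
    (hblock : Tendsto (fun ν => (B ν)⁻¹ • (G ν).submatrix I I) atTop
      (𝓝 !![(1 : ℝ), 0, 0; 0, 0, -1/2; 0, -1/2, 0]))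
    (ω : Fin 3 → ℝ) (hcross : Tendsto (fun ν a => (ρ ν)⁻¹ * G ν (I a) j) atTop (𝓝 ω)) :
    Tendsto (fun ν => G ν j j * B ν / ρ ν ^ 2) atTop (𝓝 (ω 0 ^ 2 - 4 * ω 1 * ω 2)) := by
  refine mixedWall_parity_limit_of_schur G (fun ν a b => ?_) I j B ρ hB hρ (fun ν hI => ?_) hblock ω hcross
  · obtain ⟨ε, v, u, w, h⟩ := hshape ν
    exact shape_symm ε v u w (G ν) h a b
  · obtain ⟨ε, v, u, w, h⟩ := hshape ν
    exact mixedParity_schur_entry ε v u w (G ν) h I j hI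

/-- **Eventual sign of the complement letter**: under the parity law's hypotheses and NON-DEGENERACY `q(ω) > 0`, eventually
`G^ν_jj · B ν > 0` (the letter `j`'s diagonal Gram entry takes the sign of the blow-up scale `B`). [this work] -/
theorem mixedWall_parity_eventually_pos
    (G : ℕ → Matrix (Fin 6) (Fin 6) ℝ)
    (hshape : ∀ ν, ∃ (ε : ℝ) (v u w : Fin 6 → ℝ), G ν = ε • (vecMulVec v v - vecMulVec u u - vecMulVec w w))
    (I : Fin 3 → Fin 6) (j : Fin 6) (B ρ : ℕ → ℝ) (hB : ∀ ν, B ν ≠ 0) (hρ : ∀ ν, 0 < ρ ν)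
    (hblock : Tendsto (fun ν => (B ν)⁻¹ • (G ν).submatrix I I) atTop
      (𝓝 !![(1 : ℝ), 0, 0; 0, 0, -1/2; 0, -1/2, 0]))
    (ω : Fin 3 → ℝ) (hcross : Tendsto (fun ν a => (ρ ν)⁻¹ * G ν (I a) j) atTop (𝓝 ω))
    (hq : 0 < ω 0 ^ 2 - 4 * ω 1 * ω 2) :
    ∀ᶠ ν in atTop, 0 < G ν j j * B ν := by
  have h := (mixedWall_parity_limit G hshape I j B ρ hB hρ hblock ω hcross).eventually (eventually_gt_nhds hq)
  filter_upwards [h] with ν hν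
  have hρ2 : 0 < ρ ν ^ 2 := pow_pos (hρ ν) 2
  by_contra hneg
  have hle : G ν j j * B ν ≤ 0 := not_lt.mp hneg
  have : G ν j j * B ν / ρ ν ^ 2 ≤ 0 := div_nonpos_of_nonpos_of_nonneg hle hρ2.le
  linarith

/-- **Sign of the blown-up letter**: `(B ν)⁻¹ G^ν_ii → 1`, so eventually `G^ν_ii · B ν > 0` (`i = I 0`). [this work] -/
theorem mixedWall_blownup_sign (G : ℕ → Matrix (Fin 6) (Fin 6) ℝ) (I : Fin 3 → Fin 6) (B : ℕ → ℝ) (hB : ∀ ν, B ν ≠ 0)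
    (hblock : Tendsto (fun ν => (B ν)⁻¹ • (G ν).submatrix I I) atTop
      (𝓝 !![(1 : ℝ), 0, 0; 0, 0, -1/2; 0, -1/2, 0])) :
    ∀ᶠ ν in atTop, 0 < G ν (I 0) (I 0) * B ν := by
  have h00 : Tendsto (fun ν => (B ν)⁻¹ * G ν (I 0) (I 0)) atTop (𝓝 1) := by
    have := tendsto_pi_nhds.1 (tendsto_pi_nhds.1 hblock 0) 0
    simpa [Matrix.smul_apply, Matrix.submatrix_apply] using this
  filter_upwards [h00.eventually (eventually_gt_nhds zero_lt_one)] with ν hν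
  have hB' := hB ν
  have : 0 < (B ν)⁻¹ * G ν (I 0) (I 0) * (B ν * B ν) := mul_pos hν (mul_self_pos.mpr hB')
  calc 0 < (B ν)⁻¹ * G ν (I 0) (I 0) * (B ν * B ν) := this
    _ = G ν (I 0) (I 0) * B ν := by field_simp

/-- **KILL(j)** (the card's Schur parity sieve, kernel-grade modulo the collapse regime): a sequence of realisable-shaped Gram matrices with
the mixed blow-up anatomy on `I = (i,k,l)`, a non-degenerate limit cross direction `ω` for the letter `j` (`q(ω) > 0`), and OPPOSITE signs
of `G_jj` and `G_ii` throughout does not exist. [this work] -/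
theorem mixedWall_parity_kill
    (G : ℕ → Matrix (Fin 6) (Fin 6) ℝ)
    (hshape : ∀ ν, ∃ (ε : ℝ) (v u w : Fin 6 → ℝ), G ν = ε • (vecMulVec v v - vecMulVec u u - vecMulVec w w))
    (I : Fin 3 → Fin 6) (j : Fin 6) (B ρ : ℕ → ℝ) (hB : ∀ ν, B ν ≠ 0) (hρ : ∀ ν, 0 < ρ ν)
    (hblock : Tendsto (fun ν => (B ν)⁻¹ • (G ν).submatrix I I) atTop
      (𝓝 !![(1 : ℝ), 0, 0; 0, 0, -1/2; 0, -1/2, 0]))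
    (ω : Fin 3 → ℝ) (hcross : Tendsto (fun ν a => (ρ ν)⁻¹ * G ν (I a) j) atTop (𝓝 ω))
    (hq : 0 < ω 0 ^ 2 - 4 * ω 1 * ω 2)
    (hopp : ∀ ν, G ν j j * G ν (I 0) (I 0) < 0) : False := by
  have h1 := mixedWall_parity_eventually_pos G hshape I j B ρ hB hρ hblock ω hcross hq
  have h2 := mixedWall_blownup_sign G I B hB hblock
  obtain ⟨ν, hνj, hνi⟩ := (h1.and h2).exists
  have hprod : 0 < (G ν j j * B ν) * (G ν (I 0) (I 0) * B ν) := mul_pos hνj hνi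
  have hB2 : 0 < B ν * B ν := mul_self_pos.mpr (hB ν)
  have : 0 < G ν j j * G ν (I 0) (I 0) := by
    have hrw : (G ν j j * B ν) * (G ν (I 0) (I 0) * B ν) = (G ν j j * G ν (I 0) (I 0)) * (B ν * B ν) := by ring
    rw [hrw] at hprod
    exact (mul_pos_iff_of_pos_right hB2).mp hprod
  exact absurd (hopp ν) (not_lt.mpr this.le)

/-! ## §4 When is the cross direction non-degenerate? -/

/-- **Opposite cross signs leave only the COLLAPSE REGIME**: if `ω₁ ω₂ ≤ 0` (the cross entries `(j,k)`, `(j,l)` have opposite signs in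
the limit — forced when their positions in the alternation order have different parity) then `q(ω) = ω₀² − 4ω₁ω₂ > 0` unless `ω₀ = 0` and
`ω₁ ω₂ = 0`, i.e. unless the limit cross direction is `± e_k` or `± e_l`. [this work] -/
theorem q_pos_of_opposite_cross_signs (ω : Fin 3 → ℝ) (h : ω 1 * ω 2 ≤ 0) (hnd : ω 0 ≠ 0 ∨ ω 1 * ω 2 ≠ 0) :
    0 < ω 0 ^ 2 - 4 * ω 1 * ω 2 := by
  rcases hnd with h0 | h12
  · have : 0 < ω 0 ^ 2 := by positivity
    nlinarith
  · have : ω 1 * ω 2 < 0 := lt_of_le_of_ne h h12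
    nlinarith [sq_nonneg (ω 0)]

/-- Opposite signs of the two cross entries along the sequence pass to the limit direction: `ω₁ ω₂ ≤ 0`. [this work] -/
theorem cross_limit_nonpos (G : ℕ → Matrix (Fin 6) (Fin 6) ℝ) (I : Fin 3 → Fin 6) (j : Fin 6) (ρ : ℕ → ℝ) (hρ : ∀ ν, 0 < ρ ν)
    (ω : Fin 3 → ℝ) (hcross : Tendsto (fun ν a => (ρ ν)⁻¹ * G ν (I a) j) atTop (𝓝 ω))
    (hopp : ∀ ν, G ν (I 1) j * G ν (I 2) j ≤ 0) : ω 1 * ω 2 ≤ 0 := by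
  have h1 := tendsto_pi_nhds.1 hcross 1
  have h2 := tendsto_pi_nhds.1 hcross 2
  refine le_of_tendsto (h1.mul h2) (Eventually.of_forall fun ν => ?_)
  have hρi : 0 < (ρ ν)⁻¹ := inv_pos.mpr (hρ ν)
  have : (ρ ν)⁻¹ * G ν (I 1) j * ((ρ ν)⁻¹ * G ν (I 2) j) = ((ρ ν)⁻¹ * (ρ ν)⁻¹) * (G ν (I 1) j * G ν (I 2) j) := by ring
  rw [this]
  exact mul_nonpos_of_nonneg_of_nonpos (mul_pos hρi hρi).le (hopp ν)

end Summit.ValiantsHypothesis.ValiantsHypothesis.Theorems.LacunarySymmetroidMatrixDescartes.WallBubbling
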